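import Summits.HodgeConjecture.HodgeConjecture.Theorems.CyclicUnitaryPowersHeredityPencils
import Summits.HodgeConjecture.HodgeConjecture.Theorems.CyclicUnitaryPowersCyclicSurfacePowersHodgeAlmostAll
import HarnessLib

/-!
# Route CyclicUnitaryPowers — ALMOST-EVERY BASE POINT, EVERY DIRECTION, ALL BUT COUNTABLY MANY MEMBERS: for Lebesgue-a.e.
# and quasi-every ternary `p`-form `f₀`, EVERY pencil `x₃^p = f₀ + u·g` has the Hodge conjecture on all self-powers of all but
# countably many of its members (CDK-free; unconditional)

Support file for `stmt-HodgeConjecture-19544` (`--supports … --as helper`; nothing here closes an item). Prover seat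
`hodge-nonav-prover-Ax` (g16, cell hodge-nonav), programme «HEREDITY» (H5 = H3 + programme AE).

Programme AE (g13, `exists_nullMeagre_isHodgeGenericPoint_cyclicCoverFamily`): off a MEAGRE, LEBESGUE-NULL set `M` of
coefficient vectors, the classifying point of `f₀` in the Carlson–Toledo base is Hodge generic; Deligne's lemma (tree theorem
`deligne_finiteIndex_monodromy_le_mumfordTateGroup_of_isQuasiProjectiveOver`) turns that into FI (a finite-index monodromy
subgroup inside the Mumford–Tate group); HEREDITY H3 (`hodgeConjectureFor_powers_offCountable_of_pencil_of_finiteIndex`)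
propagates FI along EVERY pencil through `f₀`. Result (`hodgeConjectureFor_powers_pencils_ae_base`, forms version
`hodgeConjectureFor_powers_pencils_ae_base_forms`): **for every `f₀ ∉ M` with `x₃^p − f₀` nonsingular and EVERY direction `g`,
all but countably many members of the pencil `x₃^p = f₀ + u·g` satisfy the Hodge conjecture on all their self-powers.**
Compare: every-base (g15 `exists_goodPencil_through`) — EVERY smooth `f₀`, SOME `g`; this file — ALMOST EVERY `f₀`, EVERY `g`.

HONEST FRAMING: unconditional (axioms standard, no named fact) but structural: `M` (meagre, null) and the countable sets are
unspecified; items 19544 ∕ 19543 stay OPEN at their Cattani–Deligne–Kaplan floor (reading (b)); rung F-H1 not moved; nothing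
here says HC ∕ HC_CM ∕ HC_AV is proved.

## References
* [Deligne1972WeilK3] P. Deligne, La conjecture de Weil pour les surfaces K3, Invent. Math. 15 (1972), Prop. 7.5.
* [CarlsonMullerStachPeters2017] J. Carlson, S. Müller-Stach, C. Peters, Period Mappings and Period Domains, 2nd ed., §15.3.
* [CarlsonToledo1999] J. A. Carlson, D. Toledo, Duke Math. J. 97 (1999), §7 Theorem 7.1.
* [VoisinHodgeII2003] C. Voisin, *Hodge Theory and Complex Algebraic Geometry II*, §5.3.1 Lemma 5.13, §6.2.1.
-/

noncomputable section

set_option linter.dupNamespace false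

namespace Summit.HodgeConjecture.HodgeConjecture.Theorems.CyclicUnitaryPowersHeredity

open scoped TensorProduct Topology
open CategoryTheory CategoryTheory.Limits AlgebraicGeometry Set MeasureTheory
open _root_.Topology _root_.Filter
open Literature.AlgebraicGeometry.Motives Literature.AlgebraicGeometry.HodgeTheory
open Literature.AlgebraicGeometry.HodgeTheory.BettiUniverse
open Literature.AlgebraicGeometry.Motives.UniversalHypersurface Literature.AlgebraicGeometry.HodgeTheory.UniversalHypersurface
open Literature.AlgebraicGeometry.Motives.SmoothHypersurface (IsNonsingularForm)
open Literature.AlgebraicTopology.SingularHomology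
open Summit.HodgeConjecture.HodgeConjecture.Theorems.CyclicUnitaryPowersGenericCyclicSurfacePowersHodge

/-- **Almost-every base point, every direction, all but countably many members** (`p ≥ 7` prime): there is a MEAGRE and
LEBESGUE-NULL set `M` of ternary coefficient vectors such that for every `f₀ ∉ M` with `x₃^p − Σ (f₀)_e x^e` nonsingular and
EVERY direction `g` there is a countable `C ⊆ ℂ` such that for every `u ∉ C`, every smooth projective `X ⊂ ℙ³` cut out by
`x₃^p − Σ_e ((f₀)_e + u g_e) x^e` and every self fibre power `Y = X^{k+1}` satisfy `HodgeConjectureFor (2(k+1)) Y`.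
Unconditional; NOT items 19544 ∕ 19543 (CDK floor). [cite: Deligne1972WeilK3, Prop. 7.5]
[cite: CarlsonMullerStachPeters2017, §15.3 (15.7) and Lemma–Definition 15.3.7] [cite: CarlsonToledo1999, §7 Theorem 7.1]
[cite: VoisinHodgeII2003, §5.3.1 Lemma 5.13] -/
theorem hodgeConjectureFor_powers_pencils_ae_base {p : ℕ} (hp : p.Prime) (h7 : 7 ≤ p) :
    ∃ M : Set (TernaryIndex p → ℂ), IsMeagre M ∧ volume M = 0 ∧
      ∀ f₀ : TernaryIndex p → ℂ, f₀ ∉ M →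
        (haveI : NeZero p := ⟨hp.ne_zero⟩
         IsNonsingularForm ℂ (cyclicCoverForm p (∑ e : TernaryIndex p, MvPolynomial.monomial e.1 (f₀ e)))) →
        ∀ g : TernaryIndex p → ℂ, ∃ C : Set ℂ, C.Countable ∧ ∀ u : ℂ, u ∉ C →
          ∀ ⦃X : SchemeOver ℂ⦄, IsSmoothProjective 2 X →
            IsHypersurfaceCutOutBy 3 (MvPolynomial.X (Fin.last 3) ^ p - MvPolynomial.rename Fin.castSucc
              (∑ e : TernaryIndex p, MvPolynomial.monomial e.1 (f₀ e + u * g e))) X →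
            ∀ ⦃k : ℕ⦄ ⦃Y : SchemeOver ℂ⦄, (∃ π : Fin (k + 1) → (Y ⟶ X), Nonempty (IsLimit (Fan.mk Y π))) →
              HodgeConjectureFor (2 * (k + 1)) Y := by
  classical
  haveI : NeZero p := ⟨hp.ne_zero⟩
  haveI : HodgeTensorFacts.{0, 0} := hodgeTensorFacts_holds
  have hf := isSmoothProjectiveFamily_cyclicCoverFamily p
  haveI : ∀ t : ComplexPoints (cyclicCoverBase p), Module.Finite ℚ (bettiCohomology (fiberOver (cyclicCoverFamily p) t) 2) :=
    fun t => finite (hf.isSmoothProjective t) 2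
  -- real (hence Hodge-symmetric) Hodge models of the fibres of the Carlson–Toledo family
  have hAm := fun t : ComplexPoints (cyclicCoverBase p) =>
    exists_isReal_hodgeModel_holds.exists_isHodgeSymmetric (hf.isSmoothProjective t)
  let A : ∀ t : ComplexPoints (cyclicCoverBase p), HodgeModel 2 (fiberOver (cyclicCoverFamily p) t) :=
    fun t => (hAm t).choose
  have hA : ∀ t, (A t).IsHodgeSymmetric := fun t => (hAm t).choose_spec
  obtain ⟨M, hM, hM0, -, hgen⟩ := exists_nullMeagre_isHodgeGenericPoint_cyclicCoverFamily p (by omega) A hA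
  refine ⟨M, hM, hM0, fun f₀ hf₀M hf₀ g => ?_⟩
  -- the classifying point of `f₀` is Hodge generic
  have hcoeff : (fun d : TernaryIndex p => (∑ e : TernaryIndex p, MvPolynomial.monomial e.1 (f₀ e)).coeff d.1) = f₀ :=
    funext fun d => coeff_sum_monomial p f₀ d
  have hgen₀ := hgen _ (isHomogeneous_sum_monomial p f₀) hf₀ (by rw [hcoeff]; exact hf₀M)
  -- Deligne's lemma: FI at the classifying point
  have hFI := (deligne_finiteIndex_monodromy_le_mumfordTateGroup_of_isQuasiProjectiveOver (cyclicCoverFamily p) 2 2 hf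
    (isQuasiProjectiveOver_totalSpz 2 p (cyclicCoverSpz p) (cyclicCoverSpz_surjective p (NeZero.ne p)))
    (isQuasiProjectiveOver_baseSpz 2 p (cyclicCoverSpz p)) (smooth_baseSpz_hom ℂ 2 p (cyclicCoverSpz p))
    (irreducibleSpace_cyclicCoverBase p) (cyclicCoverFamily_locallyTrivial p) A hA _ hgen₀).1
  -- HEREDITY H3 along every pencil through `f₀`
  exact hodgeConjectureFor_powers_offCountable_of_pencil_of_finiteIndex hp h7 f₀ g hf₀ A hA hFI

/-- The same in the language of homogeneous ternary FORMS `f₀, g` of degree `p` (the route's items): the hypothesis is on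
the coefficient vector of `f₀` (off `M`) and the members are `x₃^p = f₀ + u·g`. [cite: Deligne1972WeilK3, Prop. 7.5]
[cite: CarlsonMullerStachPeters2017, §15.3 (15.7) and Lemma–Definition 15.3.7] [cite: CarlsonToledo1999, §7 Theorem 7.1] -/
theorem hodgeConjectureFor_powers_pencils_ae_base_forms {p : ℕ} (hp : p.Prime) (h7 : 7 ≤ p) :
    ∃ M : Set ({d : Fin 3 →₀ ℕ // d.degree = p} → ℂ), IsMeagre M ∧ volume M = 0 ∧
      ∀ f₀ : MvPolynomial (Fin 3) ℂ, f₀.IsHomogeneous p →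
        (fun d : {d : Fin 3 →₀ ℕ // d.degree = p} => f₀.coeff d.1) ∉ M →
        IsNonsingularForm ℂ (cyclicCoverForm p f₀) →
        ∀ g : MvPolynomial (Fin 3) ℂ, g.IsHomogeneous p → ∃ C : Set ℂ, C.Countable ∧ ∀ u : ℂ, u ∉ C →
          ∀ ⦃X : SchemeOver ℂ⦄, IsSmoothProjective 2 X →
            IsHypersurfaceCutOutBy 3 (MvPolynomial.X (Fin.last 3) ^ p -
              MvPolynomial.rename Fin.castSucc (f₀ + MvPolynomial.C u * g)) X →
            ∀ ⦃k : ℕ⦄ ⦃Y : SchemeOver ℂ⦄, (∃ π : Fin (k + 1) → (Y ⟶ X), Nonempty (IsLimit (Fan.mk Y π))) →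
              HodgeConjectureFor (2 * (k + 1)) Y := by
  classical
  haveI : NeZero p := ⟨hp.ne_zero⟩
  obtain ⟨M, hM, hM0, hC⟩ := hodgeConjectureFor_powers_pencils_ae_base hp h7
  refine ⟨M, hM, hM0, fun f₀ hf₀ hf₀M hJ g hg => ?_⟩
  have hf₀eq : (∑ e : TernaryIndex p, MvPolynomial.monomial e.1 (f₀.coeff e.1)) = f₀ := formOfCoeffs_coeff (n := 1) (d := p) f₀ hf₀
  have hJ' : IsNonsingularForm ℂ (cyclicCoverForm p (∑ e : TernaryIndex p, MvPolynomial.monomial e.1 (f₀.coeff e.1))) := by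
    rw [hf₀eq]; exact hJ
  obtain ⟨C, hCc, hCu⟩ := hC (fun e : TernaryIndex p => f₀.coeff e.1) hf₀M hJ' (fun e : TernaryIndex p => g.coeff e.1)
  refine ⟨C, hCc, fun u hu X hX hcut k Y hY => hCu u hu hX ?_ hY⟩
  have hhom : (f₀ + MvPolynomial.C u * g).IsHomogeneous p := by
    have h1 : (MvPolynomial.C u * g).IsHomogeneous (0 + p) := (MvPolynomial.isHomogeneous_C _ u).mul hg
    rw [zero_add] at h1
    exact hf₀.add h1
  have heq : (∑ e : TernaryIndex p, MvPolynomial.monomial e.1 (f₀.coeff e.1 + u * g.coeff e.1)) =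
      f₀ + MvPolynomial.C u * g := by
    have h := formOfCoeffs_coeff (n := 1) (d := p) (f₀ + MvPolynomial.C u * g) hhom
    refine Eq.trans (Finset.sum_congr rfl fun e _ => ?_) h
    simp only [MvPolynomial.coeff_add, MvPolynomial.coeff_C_mul]
  rw [heq]
  exact hcut

end Summit.HodgeConjecture.HodgeConjecture.Theorems.CyclicUnitaryPowersHeredity

end
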